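import Summits.AtomisticToContinuum.HydrodynamicLimit.Theorems.LambertianContactSwapContactAngleEquidistributionVelocityIsotropy
import Summits.AtomisticToContinuum.HydrodynamicLimit.Theorems.LambertianContactSwapContactAngleEquidistributionKappaMeanDq
import HarnessLib

/-!
# The crux forces asymptotic isotropy of the collision relative-velocity tensor — EXPLICIT form
# (line `Sketch` v8b, stub `stub_tracelessIsotropy`; crux `LambertianContactSwap.ContactAngleEquidistribution`,
# stmt-AtomisticToContinuum-12097)

`stub_velocityIsotropy` shows that the crux forces `(N+1)^{-4/3} E_{P_N} Σ_{coll ≤ t} K_{T_N}(vᵢ, vⱼ) → 0` with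
`K_T(v, w) = ∫ Dq_T(v, w, lambertDir(−g) ξ) dγ(ξ)` the cosine-law (`κ_g`) mean of the collisional change of the quadratic
observable `⟪v, T v⟫ + ⟪w, T w⟫`; `stub_kappaMean_Dq` evaluates `K_T(v, w) = (|g|² tr T − 3⟪g, T g⟫)/6`, `g = v − w`.
Hence the EXPLICIT necessary condition (`stub_tracelessIsotropy`): if `ContactAngleEquidistribution` holds then for all
continuous profiles, small `σ`, every `Φ`, `t ≥ 0` and operators `‖T_N‖ ≤ 1`,

  `(N+1)^{-4/3} E_{P_N} Σ_{coll ≤ t} (|g_k|² tr T_N − 3⟪g_k, T_N g_k⟫) → 0`;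

for traceless `T_N` this says that the `N^{4/3}`-normalised second-moment tensor `Σ_{coll ≤ t} g_k ⊗ g_k` of the collision
relative velocities of the DETERMINISTIC hard-sphere flow, started from ANY local Gibbs state, is asymptotically isotropic — a
local-Maxwellian-in-collision-average property at fixed reduced density over macroscopic times (cf. the crux's ideator notes
F1/F7 and `Literature.Barriers.AtomisticToContinuum.BoltzmannHypothesisBarrier`). References: all statements [folklore] given the
two inputs.
-/

noncomputable section

open MeasureTheory Filter Set Topology ProbabilityTheory
open scoped ENNReal BigOperators Classical RealInnerProductSpace

namespace Summit.AtomisticToContinuum.HydrodynamicLimit.Theorems.ContactAngleEquidistributionSketch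

open Literature.Analysis.FluidPDE Literature.MathematicalPhysics.KineticTheory
open Summit.AtomisticToContinuum.HydrodynamicLimit.Theses.LambertianContactSwap

/-- **The crux forces asymptotic isotropy of the collision relative-velocity tensor, explicit form** (registered stub
`stub_tracelessIsotropy` of line `Sketch` v8b). If `ContactAngleEquidistribution` holds then for every family of continuous
profiles there is `σ₀ > 0` such that for `0 < σ < σ₀`, every `Φ`, `t ≥ 0` and operators `T_N` with `‖T_N‖ ≤ 1`,
`(N+1)^{-4/3} E_{P_N} Σ_{coll ≤ t} (|g|² tr T_N − 3⟪g, T_N g⟫) → 0` (`stub_velocityIsotropy`, whose integrand is `6⁻¹` times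
this one by `stub_kappaMean_Dq`, term by term). [folklore] -/
theorem stub_tracelessIsotropy (hCrux : ContactAngleEquidistribution) :
    let Cfg : ℕ → Type := fun N => Config (N + 1) (Fin 3) T3
    let G := Torus.geometry (Fin 3)
    let ε : ℝ → ℕ → ℝ := hsDiameter
    let τ : ℝ → (N : ℕ) → Cfg N → ℝ≥0∞ := fun σ N z => Alexander.freeExitTime G (ε σ N) z
    let S : ℝ → (N : ℕ) → Cfg N → Cfg N := fun t _ z => freeFlight G t z
    let zpre : ℝ → (N : ℕ) → Cfg N → ℕ → Cfg N := fun σ N z m =>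
      let y := Alexander.stateAfter G (ε σ N) z m; S (τ σ N y).toReal N y
    let Kt : ℝ → (N : ℕ) → Cfg N → ℝ → ℕ := fun σ N z t => Alexander.collisionCount G (ε σ N) z t
    let hit : ℝ → (N : ℕ) → Cfg N → Fin (N + 1) → Fin (N + 1) → Prop := fun σ N y i j =>
      i < j ∧ y ∈ contactSet G (N + 1) (ε σ N) i j ∧ IsIncoming G y i j
    ∀ (a₀ θ₀ : T3 → ℝ) (u₀ : T3 → V3), Continuous a₀ → Continuous θ₀ → Continuous u₀ →
      (∀ x, 0 < a₀ x) → (∀ x, 0 < θ₀ x) → ∃ σ₀ : ℝ, 0 < σ₀ ∧ ∀ σ : ℝ, 0 < σ → σ < σ₀ →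
      ∀ Φ : (N : ℕ) → HardSphereFlow G (ε σ N) (N + 1),
      let P := fun N => localGibbsLaw σ a₀ u₀ θ₀ N (Φ N)
      ∀ t : ℝ, 0 ≤ t → ∀ T : ℕ → (V3 →L[ℝ] V3), (∀ N, ‖T N‖ ≤ 1) →
        Tendsto (fun N : ℕ => ∫ z, ((N : ℝ) + 1) ^ (-(4 / 3 : ℝ)) * ∑ m ∈ Finset.range (Kt σ N z t),
          ∑ i : Fin (N + 1), ∑ j : Fin (N + 1),
            (let y := zpre σ N z m
             if hit σ N y i j then
               ‖(y i).2 - (y j).2‖ ^ 2 * LinearMap.trace ℝ V3 (T N).toLinearMap -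
                 3 * ⟪(y i).2 - (y j).2, T N ((y i).2 - (y j).2)⟫
             else 0) ∂(P N)) atTop (𝓝 0) := by
  intro Cfg G ε τ S zpre Kt hit a₀ θ₀ u₀ ha hθ hu ha0 hθ0
  obtain ⟨σ₀, hσ₀, h⟩ := stub_velocityIsotropy hCrux a₀ θ₀ u₀ ha hθ hu ha0 hθ0
  refine ⟨σ₀, hσ₀, ?_⟩
  intro σ hσ hσlt Φ P t ht T hT
  have hV := h σ hσ hσlt Φ t ht T hT
  -- the cosine-law mean of the collisional change (integrand of `stub_velocityIsotropy`)
  set Dq : (V3 →L[ℝ] V3) → V3 → V3 → V3 → ℝ := fun T' v w n =>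
    ⟪v - ⟪v - w, n⟫ • n, T' (v - ⟪v - w, n⟫ • n)⟫ + ⟪w + ⟪v - w, n⟫ • n, T' (w + ⟪v - w, n⟫ • n)⟫ -
      ⟪v, T' v⟫ - ⟪w, T' w⟫ with hDq
  set F : (N : ℕ) → Cfg N → ℝ := fun N z => ((N : ℝ) + 1) ^ (-(4 / 3 : ℝ)) *
    ∑ m ∈ Finset.range (Kt σ N z t), ∑ i : Fin (N + 1), ∑ j : Fin (N + 1),
      (let y := zpre σ N z m
       if hit σ N y i j then
         ∫ ξ, Dq (T N) (y i).2 (y j).2 (lambertDir (-((y i).2 - (y j).2)) ξ) ∂(stdGaussian V3)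
       else 0) with hF
  set Gl : (N : ℕ) → Cfg N → ℝ := fun N z => ((N : ℝ) + 1) ^ (-(4 / 3 : ℝ)) *
    ∑ m ∈ Finset.range (Kt σ N z t), ∑ i : Fin (N + 1), ∑ j : Fin (N + 1),
      (let y := zpre σ N z m
       if hit σ N y i j then
         ‖(y i).2 - (y j).2‖ ^ 2 * LinearMap.trace ℝ V3 (T N).toLinearMap -
           3 * ⟪(y i).2 - (y j).2, T N ((y i).2 - (y j).2)⟫
       else 0) with hGl
  change Tendsto (fun N : ℕ => ∫ z, F N z ∂(P N)) atTop (𝓝 0) at hV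
  change Tendsto (fun N : ℕ => ∫ z, Gl N z ∂(P N)) atTop (𝓝 0)
  -- term by term, `F = 6⁻¹ Gl`
  have hpt : ∀ N z, F N z = 6⁻¹ * Gl N z := by
    intro N z
    simp only [hF, hGl]
    rw [mul_left_comm (6⁻¹ : ℝ)]
    congr 1
    rw [Finset.mul_sum]
    refine Finset.sum_congr rfl fun m _ => ?_
    rw [Finset.mul_sum]
    refine Finset.sum_congr rfl fun i _ => ?_
    rw [Finset.mul_sum]
    refine Finset.sum_congr rfl fun j _ => ?_
    split_ifs with hh
    · exact stub_kappaMean_Dq (T N) _ _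
    · simp
  have hint : ∀ N, ∫ z, Gl N z ∂(P N) = 6 * ∫ z, F N z ∂(P N) := by
    intro N
    have h1 : ∫ z, F N z ∂(P N) = 6⁻¹ * ∫ z, Gl N z ∂(P N) := by
      rw [← integral_const_mul]
      exact integral_congr_ae (ae_of_all _ fun z => hpt N z)
    rw [h1, ← mul_assoc]
    norm_num
  have h6 := hV.const_mul (6 : ℝ)
  rw [mul_zero] at h6
  exact h6.congr fun N => (hint N).symm

end Summit.AtomisticToContinuum.HydrodynamicLimit.Theorems.ContactAngleEquidistributionSketch

end
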